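import Summits.KontsevichZagierPeriods.KontsevichZagierPeriods.Theorems.HurwitzMicroSectorsHurwitzSectorComplementStubSymReductionAlgebraAux

/-!
# `HurwitzSectorComplement` (stmt-KontsevichZagierPeriods-14341), line `galois-parity-half`,
# stub S1 `stub_symReduction` — part 3/4: the linear algebra of the numerators

Pure algebra in `ℚ[X]` modulo an abstract `ℚ`-submodule `K` containing the DISTRIBUTION
polynomials `X^β Σ_{j<p} X^{jM} − p^w X^{p(β+1)−1}` (`p` prime, `pM = L`, `β < M`) and the JACOBIAN
polynomials `((k+1)^w X^k − 1)(1 − X^L)`: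

* `poly_part` — `Q (1 − X^L) ≡ (Σ_k Q_k/(k+1)^w) (1 − X^L)`;
* `coeff_mul_geom`, `mul_geom_eq_sum` — lifting a level-`N` numerator `R` (`deg R < N`, `N ∣ L`)
  to level `L`: `R · Σ_{j<L/N} X^{jN} = Σ_{b<L} R_{b mod N} X^b`;
* `dist_of_rel` — the bridge "exponent `b` ↔ point `b + 1 ∈ ZMod L`": modulo `K` the monomial
  classes `e x = [X^{idx x}]`, `idx x = (x − 1).val`, satisfy the distribution relations at the
  primes of `symReduction_kubert`;
* `coeff_symm` — the two symmetry hypotheses of the stub say that `y ↦ R_{idx y}` on `ZMod N` is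
  `(−1)^w`-symmetric under `y ↦ −y`;
* `symReduction_algebra` (registered sub-goal) — hence `Q(1−X^L) + R Σ_j X^{jN}` is congruent
  modulo `K` to a NORMAL FORM `c (1 − X^L) + Σ_{a ∈ T_L} μ_a (X^{a−1} + (−1)^w X^{L−1−a})`.

References: S. Lang, *Cyclotomic Fields I–II* (1990), Ch. 2 §8–9; J. Milnor, Enseign. Math. 29
(1983), §1.
-/

noncomputable section

open Polynomial
open scoped BigOperators

namespace Summit.KontsevichZagierPeriods.Theorems.HurwitzMicroSectorsHurwitzSectorComplement.SymReduction

/-! ## The polynomial part -/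

/-- POLYNOMIAL PART: `Q (1 − X^L) − (Σ_k Q_k/(k+1)^w) (1 − X^L) ∈ K` — each monomial
`X^k (1 − X^L)` is `(k+1)^{−w} (1 − X^L)` modulo the Jacobian polynomial. [folklore] -/
theorem poly_part {w L : ℕ} (K : Submodule ℚ ℚ[X])
    (hE : ∀ k : ℕ, (C (((k : ℚ) + 1) ^ w) * X ^ k - 1) * (1 - X ^ L) ∈ K) (Q : ℚ[X]) :
    Q * (1 - X ^ L) - C (∑ k ∈ Finset.range (Q.natDegree + 1), Q.coeff k / ((k : ℚ) + 1) ^ w) *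
      (1 - X ^ L) ∈ K := by
  have h : Q * (1 - X ^ L) - C (∑ k ∈ Finset.range (Q.natDegree + 1),
      Q.coeff k / ((k : ℚ) + 1) ^ w) * (1 - X ^ L) = ∑ k ∈ Finset.range (Q.natDegree + 1),
        (Q.coeff k / ((k : ℚ) + 1) ^ w) • ((C (((k : ℚ) + 1) ^ w) * X ^ k - 1) * (1 - X ^ L)) := by
    conv_lhs => enter [1, 1]; rw [Q.as_sum_range_C_mul_X_pow]
    rw [map_sum, Finset.sum_mul, Finset.sum_mul, ← Finset.sum_sub_distrib]
    refine Finset.sum_congr rfl fun k _ => ?_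
    have hk : ((k : ℚ) + 1) ^ w ≠ 0 := by positivity
    have e : C (Q.coeff k / ((k : ℚ) + 1) ^ w) * C (((k : ℚ) + 1) ^ w) = C (Q.coeff k) := by
      rw [← C_mul, div_mul_cancel₀ _ hk]
    rw [smul_eq_C_mul]
    linear_combination (-(X ^ k * (1 - X ^ L))) * e
  rw [h]
  exact K.sum_mem fun k _ => K.smul_mem _ (hE k)

/-! ## Lifting a level-`N` numerator to level `L = N d` -/

/-- Coefficients of `R · Σ_{j<d} X^{jN}` for `deg R < N`: `R_{b mod N}` for `b < N d`, else `0`.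
[folklore] -/
theorem coeff_mul_geom {N d : ℕ} (hN : 0 < N) (R : ℚ[X]) (hR : R.natDegree < N) (b : ℕ) :
    (R * ∑ j ∈ Finset.range d, X ^ (j * N)).coeff b = if b < N * d then R.coeff (b % N) else 0 := by
  rw [Finset.mul_sum, finsetSum_coeff]
  simp_rw [coeff_mul_X_pow']
  split_ifs with hb
  · rw [Finset.sum_eq_single (b / N)]
    · rw [if_pos (Nat.div_mul_le_self b N)]
      congr 1
      have := Nat.div_add_mod' b N
      omega
    · intro j _ hne
      split_ifs with hle
      · apply coeff_eq_zero_of_natDegree_lt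
        have hj' : j < b / N := lt_of_le_of_ne ((Nat.le_div_iff_mul_le hN).mpr hle) hne
        have h2 : (j + 1) * N ≤ b := (Nat.le_div_iff_mul_le hN).mp hj'
        rw [add_one_mul] at h2
        omega
      · rfl
    · intro hmem
      exact absurd (Finset.mem_range.mpr ((Nat.div_lt_iff_lt_mul hN).mpr (by rwa [mul_comm] at hb)))
        hmem
  · refine Finset.sum_eq_zero fun j hj => ?_
    rw [Finset.mem_range] at hj
    split_ifs with hle
    · apply coeff_eq_zero_of_natDegree_lt
      have h2 : (j + 1) * N ≤ d * N := Nat.mul_le_mul_right N hj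
      rw [add_one_mul, mul_comm d] at h2
      omega
    · rfl

/-- The lift identity `R · Σ_{j<d} X^{jN} = Σ_{b < N d} R_{b mod N} X^b` (`deg R < N`). [folklore] -/
theorem mul_geom_eq_sum {N d : ℕ} (hN : 0 < N) (R : ℚ[X]) (hR : R.natDegree < N) :
    R * ∑ j ∈ Finset.range d, X ^ (j * N) =
      ∑ b ∈ Finset.range (N * d), C (R.coeff (b % N)) * X ^ b := by
  ext b
  rw [coeff_mul_geom hN R hR, finsetSum_coeff]
  simp_rw [coeff_C_mul_X_pow]
  rw [Finset.sum_ite_eq (Finset.range (N * d)) b]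
  simp only [Finset.mem_range]

/-! ## Exponents `b < L` ↔ points `b + 1 ∈ ZMod L` -/

/-- Reindexing a sum over `ZMod L` by the exponent `idx x = (x − 1).val ∈ [0, L)`. [folklore] -/
theorem sum_zmod_idx {L : ℕ} [NeZero L] {M : Type*} [AddCommMonoid M] (F : ℕ → M) :
    ∑ x : ZMod L, F ((x - 1).val) = ∑ b ∈ Finset.range L, F b := by
  have h1 : ∑ x : ZMod L, F ((x - 1).val) = ∑ x : ZMod L, F x.val :=
    Fintype.sum_equiv (Equiv.subRight (1 : ZMod L)) _ _ fun x => rfl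
  have h2 : (Finset.univ : Finset (ZMod L)).image ZMod.val = Finset.range L := by
    ext b
    simp only [Finset.mem_image, Finset.mem_univ, true_and, Finset.mem_range]
    exact ⟨fun ⟨x, hx⟩ => hx ▸ x.val_lt, fun hb => ⟨b, ZMod.val_cast_of_lt hb⟩⟩
  rw [h1, ← h2, Finset.sum_image fun x _ y _ h => ZMod.val_injective L h]

/-- Along `ZMod L → ZMod N` (`N ∣ L`) the exponent reduces modulo `N`:
`idx (π x) = idx x mod N`. [folklore] -/
theorem val_castHom_sub_one {N L : ℕ} [NeZero L] [NeZero N] (h : N ∣ L) (x : ZMod L) :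
    ((ZMod.castHom h (ZMod N) x) - 1).val = (x - 1).val % N := by
  rw [← map_one (ZMod.castHom h (ZMod N)), ← map_sub, ZMod.castHom_apply, ZMod.cast_eq_val,
    ZMod.val_natCast]

/-- **The bridge.** If a `ℚ`-linear `φ` kills the distribution polynomials
(`φ (X^β Σ_{j<p} X^{jM}) = p^w • φ (X^{p(β+1)−1})`, `p` prime, `pM = L`, `β < M`), then the monomial
classes `e x = φ (X^{idx x})` on `ZMod L` satisfy the distribution relations at the primes:
`p^w • e (p • z) = Σ_{p • y = p • z} e y` (the `p` preimages of `p • z` have exponents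
`β + jM`, `j < p`, `β = idx z mod M`). [cite: Lang1990, Ch. 2 §8] -/
theorem dist_of_rel {L w : ℕ} [NeZero L] {V : Type*} [AddCommGroup V] [Module ℚ V]
    (φ : ℚ[X] →ₗ[ℚ] V)
    (hD : ∀ p M β : ℕ, p.Prime → p * M = L → β < M →
      φ (X ^ β * ∑ j ∈ Finset.range p, X ^ (j * M)) = ((p : ℚ) ^ w) • φ (X ^ (p * (β + 1) - 1))) :
    ∀ p : ℕ, p.Prime → p ∣ L → ∀ z : ZMod L, ((p : ℚ) ^ w) • φ (X ^ (p • z - 1).val) =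
      ∑ y ∈ Finset.univ.filter (fun y : ZMod L => p • y = p • z), φ (X ^ (y - 1).val) := by
  intro p hp hpL z
  obtain ⟨M, hM⟩ := hpL
  have hL0 : L ≠ 0 := NeZero.ne L
  have hM0 : 0 < M := Nat.pos_of_ne_zero fun h => hL0 (by rw [hM, h, mul_zero])
  set n := (z - 1).val with hn
  have hnL : n < L := ZMod.val_lt _
  set β := n % M with hβdef
  set q := n / M with hqdef
  have hβ : β < M := Nat.mod_lt _ hM0
  have hnβ : n = β + M * q := (Nat.mod_add_div n M).symm
  have hz : z = ((n + 1 : ℕ) : ZMod L) := by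
    rw [Nat.cast_succ, hn, ZMod.natCast_zmod_val, sub_add_cancel]
  have hpz : p • z = ((p * (β + 1) : ℕ) : ZMod L) := by
    rw [hz, nsmul_eq_mul, ← Nat.cast_mul, hnβ, ZMod.natCast_eq_natCast_iff',
      show p * (β + M * q + 1) = p * (β + 1) + q * L by rw [hM]; ring, Nat.add_mul_mod_self_right]
  have hval : (p • z - 1).val = p * (β + 1) - 1 := by
    have h1 : 1 ≤ p * (β + 1) :=
      Nat.one_le_iff_ne_zero.mpr (Nat.mul_ne_zero hp.ne_zero (Nat.succ_ne_zero β))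
    rw [hpz, show ((p * (β + 1) : ℕ) : ZMod L) - 1 = ((p * (β + 1) - 1 : ℕ) : ZMod L) by
      rw [Nat.cast_sub h1, Nat.cast_one], ZMod.val_natCast, Nat.mod_eq_of_lt]
    calc p * (β + 1) - 1 < p * (β + 1) := Nat.sub_lt h1 one_pos
      _ ≤ p * M := Nat.mul_le_mul_left p hβ
      _ = L := hM.symm
  have hbd : ∀ j, j < p → β + j * M < L := fun j hj => by
    have h1 : (j + 1) * M ≤ p * M := Nat.mul_le_mul_right M hj
    rw [add_one_mul] at h1
    omega
  -- the preimage set, parametrised by exponents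
  have hS : Finset.univ.filter (fun y : ZMod L => p • y = p • z) =
      (Finset.range p).image (fun j => ((β + j * M : ℕ) : ZMod L) + 1) := by
    ext y
    simp only [Finset.mem_filter, Finset.mem_univ, true_and, Finset.mem_image, Finset.mem_range]
    constructor
    · intro hy
      have h1 : p • (y - z) = 0 := by rw [smul_sub, hy, sub_self]
      have h2 : (((p * (y - z).val : ℕ)) : ZMod L) = 0 := by
        rw [Nat.cast_mul, ZMod.natCast_zmod_val, ← nsmul_eq_mul, h1]
      rw [ZMod.natCast_eq_zero_iff] at h2
      have h3 : p * M ∣ p * (y - z).val := by rw [← hM]; exact h2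
      obtain ⟨k, hk⟩ := Nat.dvd_of_mul_dvd_mul_left hp.pos h3
      refine ⟨(q + k) % p, Nat.mod_lt _ hp.pos, ?_⟩
      have hy' : y = ((n + 1 + M * k : ℕ) : ZMod L) := by
        rw [Nat.cast_add, ← hk, ZMod.natCast_zmod_val, ← hz, add_sub_cancel]
      rw [hy', hnβ, ← Nat.cast_succ, ZMod.natCast_eq_natCast_iff']
      have e1 : β + M * q + 1 + M * k = β + (q + k) % p * M + 1 + (q + k) / p * L := by
        rw [hM]
        have := Nat.mod_add_div (q + k) p
        nlinarith [this]
      rw [e1, Nat.add_mul_mod_self_right]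
    · rintro ⟨j, -, rfl⟩
      rw [hpz, ← Nat.cast_succ, nsmul_eq_mul, ← Nat.cast_mul, ZMod.natCast_eq_natCast_iff',
        show p * (β + j * M + 1) = p * (β + 1) + j * L by rw [hM]; ring, Nat.add_mul_mod_self_right]
  have hinj : Set.InjOn (fun j => ((β + j * M : ℕ) : ZMod L) + 1) (Finset.range p) := by
    intro j hj j' hj' h
    have h' : ((β + j * M : ℕ) : ZMod L) = ((β + j' * M : ℕ) : ZMod L) := add_right_cancel h
    rw [ZMod.natCast_eq_natCast_iff', Nat.mod_eq_of_lt (hbd j (Finset.mem_range.mp hj)),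
      Nat.mod_eq_of_lt (hbd j' (Finset.mem_range.mp hj'))] at h'
    exact Nat.eq_of_mul_eq_mul_right hM0 (by omega)
  rw [hS, Finset.sum_image hinj]
  have hex : ∀ j ∈ Finset.range p, (((β + j * M : ℕ) : ZMod L) + 1 - 1).val = β + j * M :=
    fun j hj => by
      rw [add_sub_cancel_right, ZMod.val_natCast, Nat.mod_eq_of_lt (hbd j (Finset.mem_range.mp hj))]
  rw [Finset.sum_congr rfl fun j hj => by rw [hex j hj], ← map_sum, hval, ← hD p M β hp hM.symm hβ,
    Finset.mul_sum]
  congr 1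
  exact Finset.sum_congr rfl fun j _ => by rw [← pow_add]

/-! ## The symmetry of the coefficient vector -/

/-- The two symmetry hypotheses (`R_i = (−1)^w R_j` for `i + j + 2 = N`, and `R_{N−1} = 0` for odd
`w`) say: `y ↦ R_{idx y}` on `ZMod N` is `(−1)^w`-symmetric under `y ↦ −y`
(`idx (−y) = N − 2 − idx y` for `idx y ≤ N − 2`, `idx (−y) = idx y = N − 1` otherwise). [folklore] -/
theorem coeff_symm {w N : ℕ} [NeZero N] (R : ℚ[X])
    (hsym : ∀ i j : ℕ, i + j + 2 = N → R.coeff i = (-1 : ℚ) ^ w * R.coeff j)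
    (hodd : Odd w → R.coeff (N - 1) = 0) (y : ZMod N) :
    R.coeff ((-y - 1).val) = (-1 : ℚ) ^ w * R.coeff ((y - 1).val) := by
  have hN : N ≠ 0 := NeZero.ne N
  set n := (y - 1).val with hn
  have hnN : n < N := ZMod.val_lt _
  have hy : y = ((n + 1 : ℕ) : ZMod N) := by
    rw [Nat.cast_succ, hn, ZMod.natCast_zmod_val, sub_add_cancel]
  by_cases hlast : n = N - 1
  · have h1 : (-y - 1).val = N - 1 := by
      rw [hy, hlast, Nat.sub_add_cancel (Nat.one_le_iff_ne_zero.mpr hN), ZMod.natCast_self, neg_zero,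
        zero_sub, show (-1 : ZMod N) = ((N - 1 : ℕ) : ZMod N) by
          rw [Nat.cast_sub (Nat.one_le_iff_ne_zero.mpr hN), ZMod.natCast_self, Nat.cast_one, zero_sub],
        ZMod.val_natCast, Nat.mod_eq_of_lt (by omega)]
    rw [h1, hlast]
    rcases Nat.even_or_odd w with he | ho
    · rw [he.neg_one_pow, one_mul]
    · rw [hodd ho, mul_zero]
  · have hle : n + 2 ≤ N := by omega
    have h1 : (-y - 1).val = N - (n + 2) := by
      rw [hy, show -((n + 1 : ℕ) : ZMod N) - 1 = ((N - (n + 2) : ℕ) : ZMod N) by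
        rw [Nat.cast_sub hle, ZMod.natCast_self, zero_sub]; push_cast; ring,
        ZMod.val_natCast, Nat.mod_eq_of_lt (by omega)]
    rw [h1]
    exact hsym _ _ (by omega)

/-! ## The normal form modulo `K` (registered sub-goal `symReduction_algebra`) -/

/-- **The linear algebra of the reduction.** Let `K ⊆ ℚ[X]` be a `ℚ`-submodule containing the
distribution polynomials `X^β Σ_{j<p} X^{jM} − p^w X^{p(β+1)−1}` (`p` prime, `pM = L`, `β < M`) and
the Jacobian polynomials `((k+1)^w X^k − 1)(1 − X^L)` (`w ≥ 1`, `L ≥ 3`). Then for `N ∣ L`, every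
`Q ∈ ℚ[X]` and every `R` with `deg R < N` whose coefficient vector is `(−1)^w`-symmetric
(`R_i = (−1)^w R_j` for `i + j + 2 = N`, `R_{N−1} = 0` for odd `w`), the level-`L` numerator
`Q (1 − X^L) + R · Σ_{j<L/N} X^{jN}` is congruent modulo `K` to the normal form
`c (1 − X^L) + Σ_{a ∈ T_L} μ_a (X^{a−1} + (−1)^w X^{L−1−a})`, `T_L = {0 < a < L/2, gcd(a,L) = 1}`:
polynomial part by `poly_part`, polar part by Kubert generation with symmetric folding
(`symReduction_kubert`) applied to the monomial classes `[X^{idx x}]`, `x ∈ ZMod L`.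
[cite: Lang1990, Ch. 2 §8] -/
theorem symReduction_algebra : ∀ (w N L : ℕ), 1 ≤ w → 1 ≤ N → 3 ≤ L → N ∣ L → ∀ (K : Submodule ℚ (Polynomial ℚ)), (∀ p M β : ℕ, p.Prime → p * M = L → β < M → Polynomial.X ^ β * (∑ j ∈ Finset.range p, Polynomial.X ^ (j * M)) - Polynomial.C ((p : ℚ) ^ w) * Polynomial.X ^ (p * (β + 1) - 1) ∈ K) → (∀ k : ℕ, (Polynomial.C (((k : ℚ) + 1) ^ w) * Polynomial.X ^ k - 1) * (1 - Polynomial.X ^ L) ∈ K) → ∀ (Q R : Polynomial ℚ), R.natDegree < N → (∀ i j : ℕ, i + j + 2 = N → R.coeff i = (-1 : ℚ) ^ w * R.coeff j) → (Odd w → R.coeff (N - 1) = 0) → ∃ (c : ℚ) (μ : ℕ → ℚ), Q * (1 - Polynomial.X ^ L) + R * (∑ j ∈ Finset.range (L / N), Polynomial.X ^ (j * N)) - (Polynomial.C c * (1 - Polynomial.X ^ L) + ∑ a ∈ (Finset.range L).filter (fun a => 2 * a < L ∧ Nat.Coprime a L), Polynomial.C (μ a) * (Polynomial.X ^ (a -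 1) + Polynomial.C ((-1 : ℚ) ^ w) * Polynomial.X ^ (L - 1 - a))) ∈ K := by
  intro w N L hw hN hL hNL K hD hE Q R hR hsym hodd
  haveI : NeZero L := ⟨by omega⟩
  haveI : NeZero N := ⟨by omega⟩
  obtain ⟨d, hd⟩ := hNL
  have hdL : L / N = d := by rw [hd, Nat.mul_div_cancel_left d (by omega)]
  -- the quotient map by `K`
  obtain ⟨φ, hφ⟩ : ∃ φ : ℚ[X] →ₗ[ℚ] ℚ[X] ⧸ K, φ = K.mkQ := ⟨_, rfl⟩
  have hφeq : ∀ P P' : ℚ[X], φ P = φ P' ↔ P - P' ∈ K := fun P P' => by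
    rw [hφ, Submodule.mkQ_apply, Submodule.mkQ_apply, Submodule.Quotient.eq]
  -- the monomial classes satisfy the distribution relations at the primes
  have hD' : ∀ p M β : ℕ, p.Prime → p * M = L → β < M →
      φ (X ^ β * ∑ j ∈ Finset.range p, X ^ (j * M)) =
        ((p : ℚ) ^ w) • φ (X ^ (p * (β + 1) - 1)) := by
    intro p M β hp hpM hβ
    rw [← map_smul, hφeq, smul_eq_C_mul]
    exact hD p M β hp hpM hβ
  have hDist := dist_of_rel (w := w) φ hD'
  -- the `(−1)^w`-symmetric coefficient vector, pulled back from level `N`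
  have hε : ((-1 : ℚ) ^ w) * (-1) ^ w = 1 := by rw [← mul_pow, neg_one_mul, neg_neg, one_pow]
  obtain ⟨π, hπ⟩ : ∃ π : ZMod L →+* ZMod N, π = ZMod.castHom (show N ∣ L from ⟨d, hd⟩) (ZMod N) :=
    ⟨_, rfl⟩
  have hρ : ∀ x : ZMod L, R.coeff ((π (-x) - 1).val) = (-1) ^ w * R.coeff ((π x - 1).val) :=
    fun x => by
      rw [map_neg]
      exact coeff_symm R hsym hodd (π x)
  obtain ⟨μ, hμ⟩ := symReduction_kubert L w hL hw (ℚ[X] ⧸ K) (fun x => φ (X ^ (x - 1).val)) hDist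
    ((-1) ^ w) hε (fun x => R.coeff ((π x - 1).val)) hρ
  refine ⟨∑ k ∈ Finset.range (Q.natDegree + 1), Q.coeff k / ((k : ℚ) + 1) ^ w, μ, ?_⟩
  -- the polar part: `R · Σ_j X^{jN} ≡ Σ_{a ∈ T_L} μ_a (X^{a−1} + (−1)^w X^{L−1−a})`
  have h2 : φ (R * ∑ j ∈ Finset.range (L / N), X ^ (j * N)) =
      φ (∑ a ∈ (Finset.range L).filter (fun a => 2 * a < L ∧ Nat.Coprime a L),
        C (μ a) * (X ^ (a - 1) + C ((-1 : ℚ) ^ w) * X ^ (L - 1 - a))) := by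
    have hl : φ (R * ∑ j ∈ Finset.range (L / N), X ^ (j * N)) =
        ∑ x : ZMod L, R.coeff ((π x - 1).val) • φ (X ^ (x - 1).val) := by
      rw [hdL, mul_geom_eq_sum (by omega) R hR, ← hd, map_sum,
        ← sum_zmod_idx (fun b => φ (C (R.coeff (b % N)) * X ^ b))]
      refine Finset.sum_congr rfl fun x _ => ?_
      rw [← smul_eq_C_mul, map_smul, hπ, val_castHom_sub_one]
    rw [hl, hμ, map_sum]
    refine Finset.sum_congr rfl fun a ha => ?_
    have ha' : 1 ≤ a ∧ a < L := by
      simp only [Finset.mem_filter, Finset.mem_range] at ha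
      refine ⟨Nat.one_le_iff_ne_zero.mpr ?_, ha.1⟩
      rintro rfl
      have h := ha.2.2
      rw [Nat.coprime_zero_left] at h
      omega
    have hidx1 : (((a : ℕ) : ZMod L) - 1).val = a - 1 := by
      rw [show ((a : ℕ) : ZMod L) - 1 = ((a - 1 : ℕ) : ZMod L) by rw [Nat.cast_sub ha'.1, Nat.cast_one],
        ZMod.val_natCast, Nat.mod_eq_of_lt (by omega)]
    have hidx2 : (-((a : ℕ) : ZMod L) - 1).val = L - 1 - a := by
      rw [show -((a : ℕ) : ZMod L) - 1 = ((L - 1 - a : ℕ) : ZMod L) by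
          rw [Nat.sub_sub, Nat.cast_sub (by omega), ZMod.natCast_self, zero_sub]
          push_cast
          ring,
        ZMod.val_natCast, Nat.mod_eq_of_lt (by omega)]
    rw [hidx1, hidx2, ← smul_eq_C_mul, map_smul, map_add, ← smul_eq_C_mul, map_smul]
  rw [hφeq] at h2
  convert K.add_mem (poly_part K hE Q) h2 using 1
  abel

end Summit.KontsevichZagierPeriods.Theorems.HurwitzMicroSectorsHurwitzSectorComplement.SymReduction

end
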